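import Summits.ResolutionOfSingularities.ResolutionOfSingularities.Theorems.HilbertSamuelEliminationSigmaMaxModificationsCorridor3WLadderE1GeneralTower
import Summits.ResolutionOfSingularities.ResolutionOfSingularities.Theorems.HilbertSamuelEliminationSigmaMaxModificationsCorridor3WLadderE1GeneralIsoPersistence
import Summits.ResolutionOfSingularities.ResolutionOfSingularities.Theorems.HilbertSamuelEliminationSigmaMaxModificationsCorridor3WLadderMovingTwoGradeZero
import HarnessLib

/-!
# [OURS · L1 W4.2] The `e = 1` door OUTSIDE the hypersurface cell, step 6 — **THE THIRD-DOOR SOCKET `IsoLowDirDimTerminatesFreeM p` FOR EVERY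
# `p`, AT EVERY ISOLATED `e ≤ 1` STAGE, IN EVERY EMBEDDING DIMENSION — WITHOUT `Corollary637_geomDir`**
# (crux `SigmaMaxModifications` stmt-ResolutionOfSingularities-18506 / conjunct stmt-…-19249, line `w_ladder_rows` v8.5, row `stub_twoClaims` (β);
# `--supports 19249`, helper)

Stub worker res-L1-w42-stub-3 (gen 6). Sorry-free PROOF file, no definition, no named fact beyond the three doors of p545762
(`Theorem314_geomDir`, `Thm314_point_locus_geomDir` — both ⟸ F-51′ `Hironaka1970_thmIV` by res-L1-w42-stub-3 g4 — and CJS Thm. 3.10 (4)).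
OURS bookkeeping for the W4.2 crux chain (cell res-hironaka); NOT a statement of [Hironaka2017] nor of [CossartJannsenSaito2020]. AI-written;
AI review is weaker than expert review.

* **`E1Free.false_of_e1MovingChain_of_isolatedStage`** — `false_of_e1MovingChain_of_isolatedHypersurfaceStage` (p545762) with the nine
  hypersurface-presentation binders DROPPED: from a stage `c 0` reached from a maximal origin at level `3`, ISOLATED in the Hilbert–Samuel
  locus, with `e = 1`, `ē ≤ 2`, a moving chain of canonical near steps is impossible. The stage tower (p545762's `exists_e1StageTower_of_movingChain`)
  is an `e = 1` point tower isolated at its base; isolation PERSISTS to stage `1` (`isIsolatedInHSMaxLocus_succ_of_pointTower`,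
  `…E1GeneralIsoPersistence`); and an `e = 1` point tower isolated at stage `1` is impossible in every embedding dimension
  (`false_of_e1PointTower_of_isolatedStageOne`, `…E1GeneralTower`: free steps by the Hilbert-function mechanism, then stub-2's arc limit).
* `E1Free.noMovingNearChainFrom_of_isolatedStage` — the third-door shape at a reached stage isolated with `e ≤ 1`, `ē ≤ 2` (case `e = 0`:
  `noMovingNearChainFrom_of_dirDim_eq_zero_geomDir`, p503441; case `e = 1`: the above after re-basing the chain).
* **`E1Free.isoLowDirDimTerminatesFreeM_holds_of_doors : ∀ p, IsoLowDirDimTerminatesFreeM p`** modulo the three doors — the `e ≤ 1` THIRD-DOOR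
  SOCKET of the β row `stub_twoClaims` (née `stub_Wlow3M_two`) WITHOUT the OURS carrier `Corollary637_geomDir` and without any regime or
  cell restriction: CJS Cor. 6.37's role for the W-ladder is DISCHARGED FROM THE TREE.

[OURS · L1 W4.2; AI-written] [cite: CossartJannsenSaito2020, Def. 6.34, Cor. 6.37, Thm. 3.14, Thm. 3.10 (4), p. 107] [cite: CossartPiltant2009, ch. 3 I.9]
-/

set_option linter.dupNamespace false

noncomputable section

open CategoryTheory CategoryTheory.Limits AlgebraicGeometry TopologicalSpace IsLocalRing
open Literature.RingTheory.HilbertSamuel Literature.AlgebraicGeometry.Resolution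
open Literature.AlgebraicGeometry.CossartJannsenSaito2020
open Scheme.IdealSheafData
open Summit.ResolutionOfSingularities.ResolutionOfSingularities.Theorems.CampaignW42
open Summit.ResolutionOfSingularities.ResolutionOfSingularities.Theorems.SigmaMaxModificationsCorridor3
open Summit.ResolutionOfSingularities.ResolutionOfSingularities.Theorems.SigmaMaxModificationsCorridor3.Moving
open Summit.ResolutionOfSingularities.ResolutionOfSingularities.Cruxes.SigmaMaxModifications.IdeasL1C4

namespace Summit.ResolutionOfSingularities.ResolutionOfSingularities.Theorems.SigmaMaxModificationsCorridor3.E1Free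

universe u

variable {R : ∀ S : Scheme.{u}, CentreSeq S → Prop} {ν : ℕ → ℕ}

/-- **THE `e = 1` THIRD DOOR AT AN ISOLATED START, EVERY EMBEDDING DIMENSION** (module docstring): a moving `e = 1`, `ē ≤ 2` chain out of a
stage ISOLATED in the Hilbert–Samuel locus, reached from a maximal origin at level `3`, is impossible — modulo `Theorem314_geomDir`,
`Thm314_point_locus_geomDir` and CJS Thm. 3.10 (4) only; NO hypersurface datum, NO Cor. 6.37. [OURS · L1 W4.2; AI-written]
[cite: CossartJannsenSaito2020, Def. 6.34, Cor. 6.37, Thm. 3.14, Thm. 3.10 (4), p. 107] [cite: CossartPiltant2009, ch. 3 I.9] -/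
theorem false_of_e1MovingChain_of_isolatedStage (hF : Theorem314_geomDir.{u})
    (h3104 : CossartJannsenSaito2020_thm_3_10_4.{u}) (h214 : Thm314_point_locus_geomDir.{u})
    (hRf : OracleFunctional R) (hRa : OracleAdmissible R) {p : ℕ}
    {X : Scheme.{u}} [IsLocallyNoetherian X] {x : X} (hX : IsMaximalOrigin p 3 ν X x)
    {c : ℕ → MarkedStage.{u}} (h0 : Reaches R 3 ν (MarkedStage.init X x) (c 0))
    (hstep : ∀ n, CanonicalNearStep R 3 ν (c n) (c (n + 1))) (hmov : ∀ n, ∃ m, n ≤ m ∧ (c m).IsBlownUp R 3 ν)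
    (hiso0 : Iso 3 (c 0)) (he : Moving.dirDim (c 0) = 1) (hē : (c 0).geomDirDim ≤ 2) : False := by
  classical
  have hreach : ∀ n, Reaches R 3 ν (MarkedStage.init X x) (c n) := reaches_chain h0 hstep
  -- the regular value is excluded (no marked point is ever blown up there)
  by_cases hν : ν = iterPSum 3 Phi
  · obtain ⟨n, -, hb⟩ := hmov 0
    exact hX.not_isBlownUp_of_eq_iterPSum hRf hRa hν (hreach n) (hstep n) hb
  -- `ē ≤ 2` and `e ≤ 1` along the chain; `e = 1` at every blown-up stage
  have hG : ∀ n, (c n).geomDirDim ≤ 2 := fun n => (geomDirDim_chain_le h3104 hRa hX hν h0 hstep n).trans hē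
  have hE1 : ∀ n, Moving.dirDim (c n) ≤ 1 :=
    dirDim_le_one_of_chain_geomDir hF h3104 h214 projDir_line hRf hRa hX hν h0 hstep he.le hē
  have hEb : ∀ n, (c n).IsBlownUp R 3 ν → Moving.dirDim (c n) = 1 := by
    intro n hb
    rcases Nat.lt_or_ge (Moving.dirDim (c n)) 1 with hlt | h1
    · exact (false_of_isBlownUp_of_dirDim_eq_zero_geomDir hF hRf hRa hX (hreach n) hb (hstep n) (by omega) (hG n)).elim
    · exact le_antisymm (hE1 n) h1
  -- the stage tower (042 / p545762), with the waiting prefix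
  obtain ⟨g, T, y, -, hgb, hgw, hC, hycl, hover, hstalk, htr⟩ :=
    exists_e1StageTower_of_movingChain hF hRf hRa hX hν h0 hstep hmov hE1 hG
  have hO : IsMaximalOrigin p 3 ν (T.X 0) (y 0) := htr (fun Y w => IsMaximalOrigin p 3 ν Y w) (hX.of_reaches hRa (hreach (g 0)))
  -- `H = ν`, `e = 1`, `ē ≤ 2` at the marked points of the tower (stalk-local)
  have hH : ∀ n, Scheme.hsFun (T.X n) 3 (y n) = ν := by
    intro n
    haveI : IsLocallyNoetherian (T.X n) := T.ln n
    haveI : IsLocallyNoetherian (c (g n)).W := (c (g n)).ln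
    obtain ⟨e⟩ := hstalk n
    rw [hsFun_eq_of_stalkIso e 3]
    exact Scheme.mem_hsStratum_iff.mp (pt_mem_hsStratum_of_reaches hX.mem_stratum (hreach (g n)))
  have heT : ∀ n, @Scheme.dirDim (T.X n) (T.ln n) (y n) = 1 := by
    intro n
    haveI : IsLocallyNoetherian (T.X n) := T.ln n
    haveI : IsLocallyNoetherian (c (g n)).W := (c (g n)).ln
    obtain ⟨e⟩ := hstalk n
    have h1 : Literature.RingTheory.HilbertSamuel.dirDim ((c (g n)).W.presheaf.stalk (c (g n)).pt) = 1 := hEb (g n) (hgb n)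
    have h2 := Literature.RingTheory.HilbertSamuel.dirDim_eq_of_ringEquiv e.commRingCatIsoToRingEquiv
    change Literature.RingTheory.HilbertSamuel.dirDim ((T.X n).presheaf.stalk (y n)) = 1
    rw [← h1, ← h2]
  have hGT : ∀ n, @Scheme.geomDirDim (T.X n) (T.ln n) (y n) ≤ 2 := by
    intro n
    haveI : IsLocallyNoetherian (T.X n) := T.ln n
    haveI : IsLocallyNoetherian (c (g n)).W := (c (g n)).ln
    obtain ⟨e⟩ := hstalk n
    have h1 : Literature.RingTheory.HilbertSamuel.geomDirDim ((c (g n)).W.presheaf.stalk (c (g n)).pt) ≤ 2 := hG (g n)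
    change Literature.RingTheory.HilbertSamuel.geomDirDim ((T.X n).presheaf.stalk (y n)) ≤ 2
    rwa [Literature.RingTheory.HilbertSamuel.geomDirDim_eq_of_ringEquiv e.commRingCatIsoToRingEquiv] at h1
  -- structure over the field of the origin, excellence, dimension, permissibility
  obtain ⟨k, _, _, f₀, hsep, hft, hqc⟩ := hO.exists_structure
  haveI := hsep
  haveI := hft
  haveI := hqc
  obtain ⟨f, -, hf1, hf2⟩ := exists_towerStructure T f₀
  have hexc : ∀ j, Scheme.IsExcellent (T.X j) := fun j =>
    haveI := hf1 j
    Scheme.isExcellent_of_locallyOfFiniteType Stacks07QW_field_holds (f j)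
  have hdim : ∀ j, topologicalKrullDim (T.X j) ≤ ((3 : ℕ) : WithBot ℕ∞) := tower_dim_le T hO.dim_le
  have hblow : ∀ j, IsBlowup (T.π j) (vanishingIdeal ⟨{y j}, hycl j⟩) := IsoTailsHS.isBlowup_singleton_of_pointTower hC hycl
  have hperm' : ∀ j, IdealSheafData.IsPermissible (vanishingIdeal (⟨{y j}, hycl j⟩ : Closeds (T.X j))) := by
    intro j
    haveI : IsLocallyNoetherian (T.X j) := T.ln j
    exact isPermissible_singleton_of_one_le_dirDim (hycl j) (heT j).symm.le
  -- every marked point lies on `ℙ(Dir)` of the previous one: the (F1♯) door at `ē ≤ 2`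
  have hon : ∀ n, @IsOnProjDirectrix (T.X (n + 1)) (T.X n) (T.ln n) (T.π n) (y (n + 1)) := by
    intro n
    haveI : IsLocallyNoetherian (T.X n) := T.ln n
    haveI : IsLocallyNoetherian (T.X (n + 1)) := T.ln (n + 1)
    exact h214 (T.X n) (T.X (n + 1)) (T.π n) (y n) (hycl n) 3 (y (n + 1)) (hexc n) (hperm' n) (hblow n) (hdim n) (hover n)
      (geomDirHypothesis_of_geomDirDim_le_two (hGT n)) (by rw [hH (n + 1), hH n])
  -- isolation at the base of the tower: localise at `x_0`, cross the link, de-localise at `y_0` (042's three moves)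
  have hperm : ∀ j, IdealSheafData.IsPermissible (T.centreIdeal j) := by
    intro j
    haveI : IsLocallyNoetherian (T.X j) := T.ln j
    have hclj : (⟨T.C j, T.isClosed_C j⟩ : Closeds (T.X j)) = ⟨{y j}, hycl j⟩ := Closeds.ext (hC j)
    show IdealSheafData.IsPermissible (vanishingIdeal ⟨T.C j, T.isClosed_C j⟩)
    rw [hclj]
    exact hperm' j
  have hsup : ∀ j (w : T.X j), ν ≤ Scheme.hsFun (T.X j) 3 w → Scheme.hsFun (T.X j) 3 w = ν :=
    tower_supMax T hexc hperm (fun w hw => le_antisymm (hO.maximal.2 ⟨w, rfl⟩ hw) hw)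
  haveI : IsLocallyNoetherian (T.X 0) := T.ln 0
  haveI : IsLocallyNoetherian (c 0).W := (c 0).ln
  haveI : IsLocallyNoetherian (c (g 0)).W := (c (g 0)).ln
  obtain ⟨e₀⟩ := hstalk 0
  obtain ⟨e₁⟩ := nonempty_stalkIso_of_waiting hstep (a := 0) (b := g 0) (Nat.zero_le _) (fun m' _ hm' => hgw m' hm')
  have hI0 : @IsIsolatedInHSMaxLocus (T.X 0) (T.ln 0) 3 (y 0) := by
    let s := c 0
    obtain ⟨k', _, _, hg⟩ := hX.exists_stateGood_of_reaches hRa hν (hreach 0)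
    obtain ⟨f', hf', -⟩ := hg.overField
    have hsc : ∀ w : s.W, w ⤳ s.pt → Scheme.hsFun s.W 3 w ≤ Scheme.hsFun s.W 3 s.pt :=
      fun w hw => Scheme.hsFun_le_hsFun_of_specializes_over_field f' 3 hw
    let T₀ : BlowupTower.{u} :=
      { X := fun _ => s.W, ln := fun _ => s.ln, C := fun _ => ∅, isClosed_C := fun _ => isClosed_empty,
        π := fun _ => 𝟙 s.W, isBlowup := fun _ => isBlowup_id_vanishingIdeal_empty s.W }
    have h1 : IsIsolatedInHSMaxLocus (Spec (s.W.presheaf.stalk s.pt)) 3 (closedPoint (s.W.presheaf.stalk s.pt)) :=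
      T₀.isIsolatedInHSMaxLocus_localize s.pt 3 hsc hiso0
    have h2 : IsIsolatedInHSMaxLocus (Spec ((T.X 0).presheaf.stalk (y 0))) 3 (closedPoint ((T.X 0).presheaf.stalk (y 0))) :=
      isIsolatedInHSMaxLocus_spec_of_iso (e₁ ≪≫ e₀.symm) 3 h1
    haveI := hf1 0
    haveI := hf2 0
    haveI : IsNoetherian (T.X 0) := Scheme.isNoetherian_of_finiteType_over_field (f 0)
    have hmaxy : y 0 ∈ Scheme.hsMaxLocus (T.X 0) 3 := by
      rw [Scheme.mem_hsMaxLocus_iff, hH 0]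
      exact ⟨⟨y 0, hH 0⟩, fun μ ⟨w, hw⟩ hle => by subst hw; exact (hsup 0 w hle).le⟩
    have hclmax : IsClosed (Scheme.hsMaxLocus (T.X 0) 3) :=
      Scheme.isClosed_hsMaxLocus (fun μ => isClosed_hsStratumGE_over_field (f 0) (hdim 0) μ)
        (Scheme.finite_hsValues_of_isExcellent (hexc 0) 3 (hsPsi_le_of_dim_le' (hdim 0)))
    exact isIsolatedInHSMaxLocus_of_spec 3 (hycl 0) hmaxy hclmax h2
  -- isolation PERSISTS to stage `1` along the `e = 1` near step; then the general-edim point-tower theorem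
  have hI1 : @IsIsolatedInHSMaxLocus (T.X 1) (T.ln 1) 3 (y 1) :=
    isIsolatedInHSMaxLocus_succ_of_pointTower h214 hC hover hycl hH hO heT hGT 0 hI0
  exact false_of_e1PointTower_of_isolatedStageOne hC hover hycl hH hO hI1 heT hon

/-- **THE THIRD-DOOR SHAPE at a reached stage isolated with `e ≤ 1`, `ē ≤ 2`** (every grade predicate `G`): no MOVING chain of canonical
near steps reached from it — `e = 0`: `noMovingNearChainFrom_of_dirDim_eq_zero_geomDir` (p503441, door `Theorem314_geomDir`, no isolation);
`e = 1`: re-base the chain at the stage (`exists_chain_from_of_reaches`) and `false_of_e1MovingChain_of_isolatedStage`. [OURS · L1 W4.2; AI-written]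
[cite: CossartJannsenSaito2020, Cor. 6.37, Thm. 3.14, Thm. 3.10 (4)] -/
theorem noMovingNearChainFrom_of_isolatedStage (hF : Theorem314_geomDir.{u})
    (h3104 : CossartJannsenSaito2020_thm_3_10_4.{u}) (h214 : Thm314_point_locus_geomDir.{u})
    (hRf : OracleFunctional R) (hRa : OracleAdmissible R) {p : ℕ}
    {X : Scheme.{u}} [IsLocallyNoetherian X] {x : X} (hX : IsMaximalOrigin p 3 ν X x)
    {s : MarkedStage.{u}} (hreach : Reaches R 3 ν (MarkedStage.init X x) s) (hiso : Iso 3 s) (he : Moving.dirDim s ≤ 1)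
    (hē : s.geomDirDim ≤ 2) (G : MarkedStage.{u} → Prop) : NoMovingNearChainFrom R 3 ν s G := by
  rcases Nat.lt_or_ge (Moving.dirDim s) 1 with h0 | h1
  · exact noMovingNearChainFrom_of_dirDim_eq_zero_geomDir hF hRf hRa hX hreach (by omega) hē G
  · have he1 : Moving.dirDim s = 1 := le_antisymm he h1
    rintro ⟨c, hc0, hstep, -, hmov⟩
    obtain ⟨c', hc'0, hstep', hmov'⟩ := exists_chain_from_of_reaches hc0 (c := c) rfl hstep hmov
    subst hc'0
    exact false_of_e1MovingChain_of_isolatedStage hF h3104 h214 hRf hRa hX hreach hstep' hmov' hiso he1 hē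

/-- **THE THIRD-DOOR SOCKET OF THE β ROW, ALL ORIGINS, EVERY `p`, EVERY EMBEDDING DIMENSION — `IsoLowDirDimTerminatesFreeM p` modulo the three
doors** `Theorem314_geomDir`, `Thm314_point_locus_geomDir` (both ⟸ F-51′ `Hironaka1970_thmIV`, res-L1-w42-stub-3 g4) and CJS Thm. 3.10 (4) —
WITHOUT the OURS carrier `Corollary637_geomDir`: CJS Cor. 6.37's role for the W-ladder is discharged from the tree. [OURS · L1 W4.2; AI-written]
[cite: CossartJannsenSaito2020, Cor. 6.37, Thm. 3.14, Thm. 3.10 (4), Def. 6.34] [cite: CossartPiltant2009, ch. 3 I.9] -/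
theorem isoLowDirDimTerminatesFreeM_holds_of_doors (hF : Theorem314_geomDir.{0})
    (h3104 : CossartJannsenSaito2020_thm_3_10_4.{0}) (h214 : Thm314_point_locus_geomDir.{0}) (p : ℕ) :
    IsoLowDirDimTerminatesFreeM p := by
  intro R hRf hRa ν X _ x hX s hreach hiso he hē
  exact noMovingNearChainFrom_of_isolatedStage hF h3104 h214 hRf hRa hX hreach hiso he hē _

end Summit.ResolutionOfSingularities.ResolutionOfSingularities.Theorems.SigmaMaxModificationsCorridor3.E1Free

end
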